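import Summits.CriticalPhenomena.PercolationContinuityZ3.Theorems.PercNearOneGluingNoHeavyQuantFarBlockIntrinsicCore
import HarnessLib

/-!
# QUANT lane R8, front "FAR beyond trees", layer one — the SHARP intrinsic criterion for a pendant block, I: the arithmetic core
# ("block-locality at layer one is decided by the 'stem + one hair' environments")

builds on p205010 (kernel theorem, internal audit signed; external expert review pending)

Support file (`--supports stmt-CriticalPhenomena-4575`), seat `prim-quant-p1` (gen 24); memo
`run/shared/lean/prim/quant/prim-quant-p1-g24/FOR-LEAD-INTRINSIC.md` §2.  Standard axioms; no sorries; no definitions.  Graph-level theorems in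
part II (`…QuantFarBlockIntrinsicSharp`); the light-block case is `…QuantFarBlockIntrinsic` (this seat).

SETTING AND NOTATION as in `…QuantFarBlockIntrinsicCore`: environment coefficients `A₀, B, C`, `P₁ = P(#out = 1)`, `g = P(o ↔ c off Z)`, outside
sum `Σ` over `K ≥ 1` outside relays, threshold `x = 1 − t`; block data `τ` (internal marginal of a block relay), `M = M_in` (inside mean),
`0 ≤ d ≤ h ≤ 1` (virtual block numbers, `s = h − d`).

THE SHARP CRITERION.  `Block.intrinsic_arith` (part I of the light criterion) asked (B2) `τ − d ≤ s(2 − M)`, which is FAR-necessary only for LIGHT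
blocks (`M + τ ≤ 2`).  Keeping the constraint `x ≤ Σ` (there is at least one outside relay) the same linear-programming argument closes under
  (B1♯) `τ(τ − d) ≤ 2d(1 − τ)` (automatic: Harris gives `d ≥ τ²` for the least-marginal relay),
  (B2♯, light)  `M + τ ≤ 2 → τ − d ≤ s(2 − M)`,
  (B2♯, medium) `2 < M + τ → (τ − d)(M + τ) ≤ 2 s τ`,
and (B2♯) is NECESSARY for FAR(1) in every environment: it is FAR(1) for the block hung by a stem of weight `g* = min(1, 2/(M+τ))` at an observer
carrying one independent hair of weight `↓ max(2 − M, g*τ)` (a tree environment with two extra vertices).  So for blocks with `M ≤ 2` and two relays,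
FAR(1) in EVERY environment ⟺ FAR(1) in the two-parameter 'stem + hair' family ⟺ (B2♯): block-locality at layer one, in its correct form.
(Heavy blocks, `M > 2`: the stem environment alone shows that `t_S ≥ τ₀` — FAR(1) for the block alone — is necessary; it is sufficient by the exit lemma.)

PROOF SHAPE (`Block.intrinsic_arith_sharp`).  `F := A₀ + Bh + Cd ≥ A₀(1−d) + g d + B s` (mass of `J`); `A₀ ≥ x` is immediate; else Harris gives
`B ≥ gP₁ − (1−g)A₀` and the count gives `Σ A₀ ≥ (Σ − P₁)x`.  The resulting lower bound is convex piecewise-affine in `P₁` with one kink at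
`g P₁ Σ = (1−g) x (Σ − P₁)`; its value at `P₁ = Σ` is `g(d + sΣ)` (inequality (E): `≥ x`) and at the kink it is controlled by
(K) `g d Σ (g − x) + (1−g) x (g d − x) ≥ 0`.  (E) and (K) follow from (B1♯)/(B2♯) using `Σ > 2 − gM`, `x ≤ min(gτ, Σ)`, by affine interpolation in
`x` and `g` and two polynomial identities (the kink constants `d(M−τ) − τ(M+τ−2) ≥ (2−M)(τ−d)` and `d(1 − gτ) − τ(1−g)`).
NUMERICS (memo §3): on 12 000 random pendant cores × hub types and 21 structured junction families under adversarial per-edge climbs, EVERY block is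
`t_S ≥ τ₀` or satisfies (B2♯) with `M ≤ 2`: no block needs a comparison (domination) argument at layer one.
[cite: Grimmett1999, §1.3 p. 10; Thm. (2.4) p. 34] (product measure, Harris); the theorems [this work].
-/

noncomputable section

namespace Summit.CriticalPhenomena.PercolationContinuityZ3.Theorems

namespace Quant

namespace Block

open Finset MeasureTheory Set

/-- Affine interpolation: an affine function of `x` on `[0, L]` (`L > 0`) with nonnegative end values is nonnegative. [folklore] -/
theorem affine_nonneg_of_ends {α β x L : ℝ} (hL : 0 < L) (hx0 : 0 ≤ x) (hxL : x ≤ L)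
    (h0 : 0 ≤ α) (h1 : 0 ≤ α + β * L) : 0 ≤ α + β * x := by
  have e : L * (α + β * x) = α * (L - x) + (α + β * L) * x := by ring
  have h2 : L * 0 ≤ L * (α + β * x) := by
    rw [mul_zero, e]; exact add_nonneg (mul_nonneg h0 (by linarith)) (mul_nonneg h1 hx0)
  exact le_of_mul_le_mul_left h2 hL

/-- **Sharp arithmetic core.**  As `Block.intrinsic_arith`, with `K ≥ 1` and the sharp block conditions: (B1♯) `τ(τ − d) ≤ 2d(1 − τ)`,
(B2♯, light) `M + τ ≤ 2 → τ − d ≤ (h − d)(2 − M)`, (B2♯, medium) `2 < M + τ → (τ − d)(M + τ) ≤ 2(h − d)τ`.  Conclusion `x ≤ A₀ + B h + C d`.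
PROOF: reduce to `F ≥ A₀(1−d) + g d + B(h−d)` with `B ≥ gP₁ − (1−g)A₀`, `Σ A₀ ≥ (Σ − P₁)x`; the two extreme inequalities are (E) `x ≤ g(d + (h−d)Σ)`
(environment `P₁ = Σ`, `A₀ = 0`: stem + hair) and (K) `g d Σ (g − x) + (1−g) x (g d − x) ≥ 0` (the kink `gP₁ = (1−g)A₀`); both follow from the block
conditions by affine/concave interpolation in `g`, `x` and `P₁`. [this work] -/
theorem intrinsic_arith_sharp {A0 B C P1 Sig K g x τ h d M : ℝ}
    (hA0 : 0 ≤ A0) (hB : 0 ≤ B) (hC : 0 ≤ C) (hK1 : 1 ≤ K)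
    (hg0 : 0 ≤ g) (hg1 : g ≤ 1) (hτ0 : 0 ≤ τ) (hτ1 : τ ≤ 1) (hd0 : 0 ≤ d) (hdh : d ≤ h) (hh1 : h ≤ 1)
    (hτM : τ ≤ M) (hM : M ≤ 2)
    (hJ : g ≤ A0 + B + C) (hHar : (P1 + A0) * g ≤ A0 + B)
    (hKx : K * x ≤ Sig) (hSig : Sig ≤ P1 + K * A0) (hP1S : P1 ≤ Sig) (hEN : 2 < Sig + g * M) (hx : x ≤ g * τ)
    (hB1 : τ * (τ - d) ≤ 2 * d * (1 - τ))
    (hB2l : M + τ ≤ 2 → τ - d ≤ (h - d) * (2 - M))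
    (hB2m : 2 < M + τ → (τ - d) * (M + τ) ≤ 2 * (h - d) * τ) :
    x ≤ A0 + B * h + C * d := by
  have hd1 : d ≤ 1 := hdh.trans hh1
  rcases le_or_gt x 0 with hxnp | hxpos
  · have : 0 ≤ B * h := mul_nonneg hB (hd0.trans hdh)
    have : 0 ≤ C * d := mul_nonneg hC hd0
    linarith
  have hgτpos : 0 < g * τ := lt_of_lt_of_le hxpos hx
  have hgpos : 0 < g := by
    rcases lt_or_eq_of_le hg0 with h' | h'
    · exact h'
    · rw [← h'] at hgτpos; simp at hgτpos
  have hgx : x ≤ g := hx.trans (mul_le_of_le_one_right hg0 hτ1)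
  have hgM : g * M ≤ M := mul_le_of_le_one_left (hτ0.trans hτM) hg1
  have hSpos : 0 < Sig := by linarith
  have hxS : x ≤ Sig := le_trans (by nlinarith) hKx
  set s := h - d with hs
  have hs0 : 0 ≤ s := by rw [hs]; linarith
  -- step 1
  have hstep : A0 * (1 - d) + g * d + B * s ≤ A0 + B * h + C * d := by
    have h1 : (g - A0 - B) * d ≤ C * d := mul_le_mul_of_nonneg_right (by linarith) hd0
    have h2 : A0 * (1 - d) + g * d + B * s = A0 + B * h + (g - A0 - B) * d := by rw [hs]; ring
    rw [h2]; linarith only [h1]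
  refine le_trans ?_ hstep
  rcases le_or_gt x A0 with hA0x | hA0x
  · have e1 : x * (1 - d) ≤ A0 * (1 - d) := mul_le_mul_of_nonneg_right hA0x (by linarith)
    have e2 : x * d ≤ g * d := mul_le_mul_of_nonneg_right hgx hd0
    have e3 : 0 ≤ B * s := mul_nonneg hB hs0
    have e4 : x = x * (1 - d) + x * d := by ring
    rw [e4]; linarith only [e1, e2, e3]
  -- `A₀ < x`
  have hcount : (Sig - P1) * x ≤ Sig * A0 := by
    have e1 : (Sig - P1) * x ≤ K * A0 * x := mul_le_mul_of_nonneg_right (by linarith) hxpos.le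
    have e2 : K * x * A0 ≤ Sig * A0 := mul_le_mul_of_nonneg_right hKx hA0
    have e3 : K * A0 * x = K * x * A0 := by ring
    linarith only [e1, e2, e3]
  have hBlow : g * P1 - (1 - g) * A0 ≤ B := by linarith
  ------------------------------------------------------------------
  -- (E) and (K) from the block conditions
  ------------------------------------------------------------------
  have hEK : x ≤ g * (d + s * Sig) ∧ 0 ≤ g * d * Sig * (g - x) + (1 - g) * x * (g * d - x) := by
    rcases le_or_gt τ d with hτd | hτd
    · -- exit regime `d ≥ τ`: both trivial since `x ≤ gτ ≤ g d`
      have hxgd : x ≤ g * d := hx.trans (mul_le_mul_of_nonneg_left hτd hg0)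
      refine ⟨?_, ?_⟩
      · have : 0 ≤ g * (s * Sig) := mul_nonneg hg0 (mul_nonneg hs0 hSpos.le)
        nlinarith
      · have e1 : 0 ≤ g * d * Sig * (g - x) := mul_nonneg (mul_nonneg (mul_nonneg hg0 hd0) hSpos.le) (by linarith)
        have e2 : 0 ≤ (1 - g) * x * (g * d - x) := mul_nonneg (mul_nonneg (by linarith) hxpos.le) (by linarith)
        linarith
    -- now `d < τ`; the kink constant `Kb = d(M−τ) − τ(M+τ−2) ≥ (2−M)(τ−d) ≥ 0`
    have hKb : 0 ≤ d * (M - τ) - τ * (M + τ - 2) := by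
      have i : d * (M - τ) - τ * (M + τ - 2) = (2 - M) * (τ - d) + (2 * d * (1 - τ) - τ * (τ - d)) := by ring
      have : 0 ≤ (2 - M) * (τ - d) := mul_nonneg (by linarith) (sub_nonneg.2 hτd.le)
      rw [i]; linarith
    have hS2 : ∀ {u : ℝ}, 2 < u * (M + τ) → u ≤ 1 → 2 < M + τ := by
      intro u hu hu1
      have : u * (M + τ) ≤ M + τ := mul_le_of_le_one_left (by linarith) hu1
      linarith
    refine ⟨?_, ?_⟩
    · -- (E)
      by_cases hgl : g * (M + τ) ≤ 2
      · -- `τ − d ≤ s(2 − gM) ≤ s Σ`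
        have hτd' : τ - d ≤ s * (2 - g * M) := by
          by_cases hl : M + τ ≤ 2
          · have := hB2l hl
            have : s * (2 - M) ≤ s * (2 - g * M) := mul_le_mul_of_nonneg_left (by linarith) hs0
            linarith
          · have hm := hB2m (lt_of_not_ge hl)
            -- `s(2 − gM)(M+τ) ≥ 2 s τ` since `2M ≥ gM(M+τ)`
            have f1 : g * (M + τ) * M ≤ 2 * M := mul_le_mul_of_nonneg_right hgl (hτ0.trans hτM)
            have f1' : 2 * τ ≤ (2 - g * M) * (M + τ) := by
              have : (2 - g * M) * (M + τ) = 2 * τ + (2 * M - g * (M + τ) * M) := by ring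
              rw [this]; linarith
            have f2 : s * (2 * τ) ≤ s * ((2 - g * M) * (M + τ)) := mul_le_mul_of_nonneg_left f1' hs0
            have f3 : (τ - d) * (M + τ) ≤ (s * (2 - g * M)) * (M + τ) := by
              have : (s * (2 - g * M)) * (M + τ) = s * ((2 - g * M) * (M + τ)) := by ring
              rw [this]; linarith
            exact le_of_mul_le_mul_right f3 (by linarith)
        have e1 : s * (2 - g * M) ≤ s * Sig := mul_le_mul_of_nonneg_left (by linarith) hs0
        have e2 : g * τ ≤ g * (d + s * Sig) := mul_le_mul_of_nonneg_left (by linarith) hg0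
        linarith
      · have hgl : 2 < g * (M + τ) := lt_of_not_ge hgl
        have hmτ : 2 < M + τ := hS2 hgl hg1
        have hm := hB2m hmτ
        -- `τ − d ≤ g s τ`
        have hst : 0 ≤ s * τ := mul_nonneg hs0 hτ0
        have f0 : 2 * (s * τ) ≤ g * (M + τ) * (s * τ) := mul_le_mul_of_nonneg_right hgl.le hst
        have f1 : (τ - d) * (M + τ) ≤ (g * s * τ) * (M + τ) := by
          have i1 : (g * s * τ) * (M + τ) = g * (M + τ) * (s * τ) := by ring
          have i2 : 2 * (h - d) * τ = 2 * (s * τ) := by rw [hs]; ring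
          rw [i1]; linarith [hm, i2, f0]
        have f2 : τ - d ≤ g * s * τ := le_of_mul_le_mul_right f1 (by linarith)
        -- `g(d + sΣ) ≥ g(d + s x) ≥ x`
        have e1' : s * x ≤ s * Sig := mul_le_mul_of_nonneg_left hxS hs0
        have e1 : g * (d + s * x) ≤ g * (d + s * Sig) := mul_le_mul_of_nonneg_left (by linarith) hg0
        have hgs1 : g * s ≤ 1 := by
          calc g * s ≤ 1 * 1 := mul_le_mul hg1 (by linarith) hs0 zero_le_one
            _ = 1 := one_mul 1
        have e2 : x * (1 - g * s) ≤ g * τ * (1 - g * s) := mul_le_mul_of_nonneg_right hx (by linarith)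
        have f3 : g * (τ - d) ≤ g * (g * s * τ) := mul_le_mul_of_nonneg_left f2 hg0
        have i3 : g * (d + s * x) = g * d + g * s * x := by ring
        have i4 : x * (1 - g * s) = x - g * s * x := by ring
        have i5 : g * τ * (1 - g * s) = g * τ - g * (g * s * τ) := by ring
        linarith
    · -- (K)
      by_cases hxm : x ≤ 2 - g * M
      · -- use `Σ ≥ 2 − gM`
        have e0 : g * d * (2 - g * M) * (g - x) ≤ g * d * Sig * (g - x) := by
          have : g * d * (2 - g * M) ≤ g * d * Sig := mul_le_mul_of_nonneg_left (by linarith) (mul_nonneg hg0 hd0)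
          exact mul_le_mul_of_nonneg_right this (by linarith)
        suffices hA : 0 ≤ g * d * (2 - g * M) * (g - x) + (1 - g) * x * (g * d - x) by linarith
        by_cases hgl : g * (M + τ) ≤ 2
        · -- `x ≤ gτ ≤ 2 − gM`; affine lower bound in `x` via `x² ≤ x·gτ`
          have e1 : (1 - g) * x * x ≤ (1 - g) * x * (g * τ) := mul_le_mul_of_nonneg_left hx (mul_nonneg (by linarith) hxpos.le)
          -- f(x) := g d (2−gM)(g − x) + (1−g) x (g d − gτ), affine, f(0) ≥ 0, f(gτ) = g²[(1−g)(2d(1−τ) − τ(τ−d)) + g d(2−M)(1−τ)] ≥ 0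
          have hf0 : 0 ≤ g * d * (2 - g * M) * g := by
            have : 0 ≤ 2 - g * M := by linarith
            positivity
          have hf1 : 0 ≤ g * d * (2 - g * M) * g + ((1 - g) * (g * d - g * τ) - g * d * (2 - g * M)) * (g * τ) := by
            have i1 : g * d * (2 - g * M) * g + ((1 - g) * (g * d - g * τ) - g * d * (2 - g * M)) * (g * τ) =
                g ^ 2 * ((1 - g) * (2 * d * (1 - τ) - τ * (τ - d)) + g * (d * (2 - M) * (1 - τ))) := by ring
            rw [i1]
            have : 0 ≤ (1 - g) * (2 * d * (1 - τ) - τ * (τ - d)) := mul_nonneg (by linarith) (by linarith)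
            have : 0 ≤ g * (d * (2 - M) * (1 - τ)) := mul_nonneg hg0 (mul_nonneg (mul_nonneg hd0 (by linarith)) (by linarith))
            positivity
          have haff := affine_nonneg_of_ends hgτpos hxpos.le hx hf0 hf1
          have i2 : g * d * (2 - g * M) * (g - x) + (1 - g) * x * (g * d - g * τ) =
              g * d * (2 - g * M) * g + ((1 - g) * (g * d - g * τ) - g * d * (2 - g * M)) * x := by ring
          linarith [haff, i2, e1]
        · have hgl : 2 < g * (M + τ) := lt_of_not_ge hgl
          have hmτ : 2 < M + τ := hS2 hgl hg1
          set S := M + τ with hSdef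
          set Sg0 := 2 - g * M with hSg0
          have hSg00 : 0 ≤ Sg0 := by rw [hSg0]; linarith
          -- affine in `x ∈ [0, Sg0]` via `x² ≤ x Sg0`; end value at `Sg0` is `Sg0·ψ(g)`
          have e1 : (1 - g) * x * x ≤ (1 - g) * x * Sg0 := mul_le_mul_of_nonneg_left hxm (mul_nonneg (by linarith) hxpos.le)
          have hψ : 0 ≤ g * d * (g * M - 1) - (1 - g) * (2 - g * M) := by
            -- identity `ψ·S(S−2) = (gS−2)·S·d(M−1) + 2(1−g)Kb + M(1−d)(gS−2)(1−g)(S−2)`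
            have i1 : (g * d * (g * M - 1) - (1 - g) * (2 - g * M)) * (S * (S - 2)) =
                (g * S - 2) * S * (d * (M - 1)) + 2 * (1 - g) * (d * (M - τ) - τ * (M + τ - 2)) +
                  M * (1 - d) * (g * S - 2) * (1 - g) * (S - 2) := by rw [hSdef]; ring
            have hM1 : 1 ≤ M := by linarith
            have t1 : 0 ≤ (g * S - 2) * S * (d * (M - 1)) :=
              mul_nonneg (mul_nonneg (by linarith) (by linarith)) (mul_nonneg hd0 (by linarith))
            have t2 : 0 ≤ 2 * (1 - g) * (d * (M - τ) - τ * (M + τ - 2)) := mul_nonneg (by linarith) hKb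
            have t3 : 0 ≤ M * (1 - d) * (g * S - 2) * (1 - g) * (S - 2) :=
              mul_nonneg (mul_nonneg (mul_nonneg (mul_nonneg (by linarith) (by linarith)) (by linarith)) (by linarith)) (by linarith)
            have hSS : 0 < S * (S - 2) := mul_pos (by linarith) (by linarith)
            have h3 : 0 * (S * (S - 2)) ≤ (g * d * (g * M - 1) - (1 - g) * (2 - g * M)) * (S * (S - 2)) := by
              rw [i1, zero_mul]; linarith
            exact le_of_mul_le_mul_right h3 hSS
          by_cases hSg0pos : 0 < Sg0
          · have hf0 : 0 ≤ g * d * Sg0 * g := by positivity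
            have hf1 : 0 ≤ g * d * Sg0 * g + ((1 - g) * (g * d - Sg0) - g * d * Sg0) * Sg0 := by
              have i2 : g * d * Sg0 * g + ((1 - g) * (g * d - Sg0) - g * d * Sg0) * Sg0 =
                  Sg0 * (g * d * (g * M - 1) - (1 - g) * (2 - g * M)) := by rw [hSg0]; ring
              rw [i2]; exact mul_nonneg hSg00 hψ
            have haff := affine_nonneg_of_ends hSg0pos hxpos.le hxm hf0 hf1
            have i3 : g * d * Sg0 * (g - x) + (1 - g) * x * (g * d - Sg0) =
                g * d * Sg0 * g + ((1 - g) * (g * d - Sg0) - g * d * Sg0) * x := by ring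
            linarith [haff, i3, e1]
          · -- `Sg0 = 0` forces `x ≤ 0`: contradiction
            exfalso
            have : Sg0 ≤ 0 := le_of_not_gt hSg0pos
            linarith
      · -- `x > 2 − gM`: use `Σ ≥ x`
        have hxm : 2 - g * M < x := lt_of_not_ge hxm
        have hgl : 2 < g * (M + τ) := by
          have : g * (M + τ) = g * M + g * τ := by ring
          linarith
        have hmτ : 2 < M + τ := hS2 hgl hg1
        set S := M + τ with hSdef
        have e0 : g * d * x * (g - x) ≤ g * d * Sig * (g - x) :=
          mul_le_mul_of_nonneg_right (mul_le_mul_of_nonneg_left hxS (mul_nonneg hg0 hd0)) (by linarith)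
        -- `C_B(g) := d(1 − gτ) − τ(1−g) ≥ 0` via `C_B·(S−2) = (gS−2) d(1−τ) + (1−g) Kb`
        have hCB : 0 ≤ d * (1 - g * τ) - τ * (1 - g) := by
          have i1 : (d * (1 - g * τ) - τ * (1 - g)) * (S - 2) = (g * S - 2) * (d * (1 - τ)) + (1 - g) * (d * (M - τ) - τ * (M + τ - 2)) := by
            rw [hSdef]; ring
          have t1 : 0 ≤ (g * S - 2) * (d * (1 - τ)) := mul_nonneg (by linarith) (mul_nonneg hd0 (by linarith))
          have t2 : 0 ≤ (1 - g) * (d * (M - τ) - τ * (M + τ - 2)) := mul_nonneg (by linarith) hKb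
          have : 0 ≤ (d * (1 - g * τ) - τ * (1 - g)) * (S - 2) := by rw [i1]; linarith
          exact le_of_mul_le_mul_right (by linarith [this] : 0 * (S - 2) ≤ (d * (1 - g * τ) - τ * (1 - g)) * (S - 2)) (by linarith)
        -- `x(gd + 1 − g) ≤ gτ(gd + 1 − g) ≤ g d`
        have hgd0 : 0 ≤ g * d := mul_nonneg hg0 hd0
        have e1 : x * (g * d + 1 - g) ≤ g * τ * (g * d + 1 - g) := mul_le_mul_of_nonneg_right hx (by linarith)
        have e2 : g * τ * (g * d + 1 - g) ≤ g * d := by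
          have : g * (τ * (g * d + 1 - g)) ≤ g * d := mul_le_mul_of_nonneg_left (by linarith) hg0
          linarith [show g * τ * (g * d + 1 - g) = g * (τ * (g * d + 1 - g)) by ring]
        have i2 : g * d * x * (g - x) + (1 - g) * x * (g * d - x) = x * (g * d - x * (g * d + 1 - g)) := by ring
        have : 0 ≤ x * (g * d - x * (g * d + 1 - g)) := mul_nonneg hxpos.le (by linarith)
        linarith
  obtain ⟨hE, hKink⟩ := hEK
  ------------------------------------------------------------------
  -- the `(A₀, P₁)` analysis
  ------------------------------------------------------------------
  set u := g * P1 * Sig - (1 - g) * x * (Sig - P1) with hu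
  have hpos : 0 < g * Sig + (1 - g) * x := by
    have := mul_pos hgpos hSpos
    have := mul_nonneg (sub_nonneg.2 hg1) hxpos.le
    linarith
  by_cases hule : u ≤ 0
  · -- kink side: `B ≥ 0`; `A₀ (gΣ + (1−g)x) ≥ x g Σ`
    have e0 : 0 ≤ B * s := mul_nonneg hB hs0
    have hule' : g * P1 * Sig ≤ (1 - g) * x * (Sig - P1) := by rw [hu] at hule; linarith
    have hA0low : x * g * Sig ≤ A0 * (g * Sig + (1 - g) * x) := by
      have a1 : g * Sig * ((Sig - P1) * x) ≤ g * Sig * (Sig * A0) := mul_le_mul_of_nonneg_left hcount (mul_nonneg hg0 hSpos.le)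
      have b1 : x * (g * P1 * Sig) ≤ x * ((1 - g) * x * (Sig - P1)) := mul_le_mul_of_nonneg_left hule' hxpos.le
      have a2 : (1 - g) * x * ((Sig - P1) * x) ≤ (1 - g) * x * (Sig * A0) :=
        mul_le_mul_of_nonneg_left hcount (mul_nonneg (sub_nonneg.2 hg1) hxpos.le)
      have i1 : Sig * (x * g * Sig) = g * Sig * ((Sig - P1) * x) + x * (g * P1 * Sig) := by ring
      have i2 : Sig * (A0 * (g * Sig + (1 - g) * x)) = g * Sig * (Sig * A0) + (1 - g) * x * (Sig * A0) := by ring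
      have i3 : x * ((1 - g) * x * (Sig - P1)) = (1 - g) * x * ((Sig - P1) * x) := by ring
      have f5 : Sig * (x * g * Sig) ≤ Sig * (A0 * (g * Sig + (1 - g) * x)) := by
        rw [i1, i2]; linarith only [a1, b1, a2, i3]
      exact le_of_mul_le_mul_left f5 hSpos
    -- `(A₀(1−d) + gd − x)(gΣ + (1−g)x) ≥ xgΣ(1−d) + (gd − x)(gΣ + (1−g)x) = Kink ≥ 0`
    have f6 : 0 ≤ (A0 * (1 - d) + g * d - x) * (g * Sig + (1 - g) * x) := by
      have i1 : x * g * Sig * (1 - d) + (g * d - x) * (g * Sig + (1 - g) * x) =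
          g * d * Sig * (g - x) + (1 - g) * x * (g * d - x) := by ring
      have i2 : (A0 * (1 - d) + g * d - x) * (g * Sig + (1 - g) * x) =
          A0 * (g * Sig + (1 - g) * x) * (1 - d) + (g * d - x) * (g * Sig + (1 - g) * x) := by ring
      have f7 : x * g * Sig * (1 - d) ≤ A0 * (g * Sig + (1 - g) * x) * (1 - d) := mul_le_mul_of_nonneg_right hA0low (by linarith)
      rw [i2]; linarith only [f7, i1, hKink]
    have f8 : 0 * (g * Sig + (1 - g) * x) ≤ (A0 * (1 - d) + g * d - x) * (g * Sig + (1 - g) * x) := by rw [zero_mul]; exact f6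
    have := le_of_mul_le_mul_right f8 hpos
    linarith
  · -- beyond the kink: `B ≥ gP₁ − (1−g)A₀`, `A₀ ≥ x(Σ−P₁)/Σ`
    have hule : 0 < u := lt_of_not_ge hule
    have e0 : (g * P1 - (1 - g) * A0) * s ≤ B * s := mul_le_mul_of_nonneg_right hBlow hs0
    have e0' : (g * P1 - (1 - g) * A0) * s = s * g * P1 - s * (1 - g) * A0 := by ring
    -- F ≥ A0 ((1−d) − s(1−g)) + g d + s g P1 =: F2
    have hcoef : 0 ≤ (1 - d) - s * (1 - g) := by
      have : s * (1 - g) ≤ s := mul_le_of_le_one_right hs0 (by linarith)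
      rw [hs] at this ⊢; linarith
    suffices hsuf : Sig * x ≤ Sig * (A0 * ((1 - d) - s * (1 - g)) + g * d + s * g * P1) by
      have := le_of_mul_le_mul_left hsuf hSpos
      linarith
    have f1 : (Sig - P1) * x * ((1 - d) - s * (1 - g)) ≤ Sig * A0 * ((1 - d) - s * (1 - g)) :=
      mul_le_mul_of_nonneg_right hcount hcoef
    -- R(P1) := x(Σ−P1)((1−d) − s(1−g)) + g d Σ + s g P1 Σ ≥ x Σ
    suffices hR : Sig * x ≤ x * (Sig - P1) * ((1 - d) - s * (1 - g)) + g * d * Sig + s * g * P1 * Sig by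
      have i : Sig * (A0 * ((1 - d) - s * (1 - g)) + g * d + s * g * P1) =
          Sig * A0 * ((1 - d) - s * (1 - g)) + g * d * Sig + s * g * P1 * Sig := by ring
      have i' : x * (Sig - P1) * ((1 - d) - s * (1 - g)) = (Sig - P1) * x * ((1 - d) - s * (1 - g)) := by ring
      rw [i]; linarith only [hR, f1, i']
    by_cases hsl : 0 ≤ s * (g * Sig + (1 - g) * x) - x * (1 - d)
    · -- identity: (R − xΣ)(gΣ + (1−g)x) = Σ·Kink + u·[s(gΣ + (1−g)x) − x(1−d)]
      have i1 : (x * (Sig - P1) * ((1 - d) - s * (1 - g)) + g * d * Sig + s * g * P1 * Sig - Sig * x) * (g * Sig + (1 - g) * x) =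
          Sig * (g * d * Sig * (g - x) + (1 - g) * x * (g * d - x)) + u * (s * (g * Sig + (1 - g) * x) - x * (1 - d)) := by
        rw [hu]; ring
      have h3 : 0 ≤ (x * (Sig - P1) * ((1 - d) - s * (1 - g)) + g * d * Sig + s * g * P1 * Sig - Sig * x) * (g * Sig + (1 - g) * x) := by
        rw [i1]; exact add_nonneg (mul_nonneg hSpos.le hKink) (mul_nonneg hule.le hsl)
      have h4 : 0 * (g * Sig + (1 - g) * x) ≤ (x * (Sig - P1) * ((1 - d) - s * (1 - g)) + g * d * Sig + s * g * P1 * Sig - Sig * x) *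
          (g * Sig + (1 - g) * x) := by rw [zero_mul]; exact h3
      have := le_of_mul_le_mul_right h4 hpos
      linarith
    · -- slope ≤ 0: `R(P₁) ≥ R(Σ) = Σ g (d + sΣ) ≥ Σ x`
      have hsl : s * (g * Sig + (1 - g) * x) - x * (1 - d) < 0 := lt_of_not_ge hsl
      have f2 : x * Sig ≤ g * (d + s * Sig) * Sig := mul_le_mul_of_nonneg_right hE hSpos.le
      have i2 : x * (Sig - P1) * ((1 - d) - s * (1 - g)) + g * d * Sig + s * g * P1 * Sig =
          g * (d + s * Sig) * Sig + (Sig - P1) * (x * (1 - d) - s * (g * Sig + (1 - g) * x)) := by ring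
      have f3 : 0 ≤ (Sig - P1) * (x * (1 - d) - s * (g * Sig + (1 - g) * x)) := mul_nonneg (sub_nonneg.2 hP1S) (by linarith)
      rw [i2]; linarith only [f2, f3]

end Block
end Quant
end Summit.CriticalPhenomena.PercolationContinuityZ3.Theorems
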